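import Summits.AtomisticToContinuum.Crystallization.Theses.ThreeConeCertificate
import Summits.AtomisticToContinuum.Crystallization.Theorems.ThreeConeCertificateExactCertificateNoGapPeriodic
import Summits.AtomisticToContinuum.Crystallization.Theorems.ThreeConeCertificateExactCertificatePeriodicMinimum
import Summits.AtomisticToContinuum.Crystallization.Theorems.ThreeConeCertificateExactCertificateLocalToGlobal
import Summits.AtomisticToContinuum.Crystallization.Theorems.ThreeConeCertificateExactCertificateDesignComposition
import Summits.AtomisticToContinuum.Crystallization.Theorems.ThreeConeCertificateExactCertificateDesignKepler

/-!
# Line `Ideator5Sketch` (idea card `robust-soft-flyspeck`) — skeleton v3 for crux `ExactCertificate`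
# (stmt-AtomisticToContinuum-11959)

Crux (route `ThreeConeCertificate`, rank 3; also support of `BraggSlacknessRigidity`):
`Summit.AtomisticToContinuum.Crystallization.Theses.ThreeConeCertificate.ExactCertificate` —
`∃ P ρ c g U f`, (S1) `V_LJ = g + U + f` on `(0,∞)`, (S2) `U ≥ 0` on `(0,∞)`, (S3) `g ≡ 0` on `[ρ,∞)`,
(S4) `f` radially of positive type on `ℝ³`, (S5) `g` is `c`-stable on finite injective configurations,
(S6) `c + f 0 / 2 = −e_LJ(P)`.

THE LINE (crux-ideate round 2, ideator 5; evidence `Ideator5Sketch.lean` = first-lemma signatures of the card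
`Ideas/robust-soft-flyspeck.md`, owned here as a skeleton by line lead a1).  Architecture of the card: certify the
designed FINITE-RANGE core `g_f := (V_LJ − f)·1_{(0,ρ)}` by ONE local (one-centre) inequality with ZERO-SUM
TRANSFERS `T(Q,x)` at every site `x` of every periodic configuration `Q`; summing over a motif kills the transfers
and gives the periodic lower bound `e_Q(g_f) ≥ −c`; the tree's periodisation lemma
(`NoGap.stable_of_periodic_bound`) turns a periodic lower bound for a finite-range potential into clause (S5);
with the design identities (`f` of positive type, `f ≤ V_LJ` beyond `ρ`, `c + f 0/2 = −e_LJ(P₀)`) this is the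
crux, and `KeplerBound` is read off the witness.  Registered stubs (collapsed form — the gate types no jets,
boxes or transfer radii, so `T` is an arbitrary zero-sum bookkeeping function):

* `stub_localToGlobal` (= the sketch's `energyPerParticle_ge_of_localInequality`, signature verbatim; provable
  now, S): a site functional `½·Σ_{y ∈ Q∖x} g(|x−y|) + T(Q,x)` bounded below by `−c` at every motif site, with
  `Σ_{x ∈ motif Q} T(Q,x) = 0`, gives `−c ≤ e_Q(g)` (sum over the motif, divide by `2·#motif`).
* `stub_composition` (= the sketch's `exactCertificate_of_design_and_periodicCoreBound`, signature verbatim;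
  provable now, S): a template `P₀`, a range `ρ`, a radial positive-type `f` with `f ≤ V_LJ` on `[ρ,∞) ∩ (0,∞)`
  and the periodic core bound `∀ Q, e_LJ(P₀) + f 0/2 ≤ e_Q(g_f)` give the crux (normal-form split
  `g := g_f`, `U := (V_LJ − f)·1_{[ρ,∞)}`, `c := −(e_LJ(P₀) + f 0/2)`; (S5) by `NoGap.stable_of_periodic_bound`).
* `stub_design` (THE CONTENT; hardest, held by the lead): the data `(P₀, ρ, c, f, T)` with the local inequality
  for `g_f` and the value identity.  HONEST SIZE: with unrestricted transfers the local inequality is EQUIVALENT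
  to the periodic core bound (take `T(Q,x) := e_Q(g_f) − ½·(site sum at x)`), so the typed stub is equivalent to
  the crux itself (`stub_designIffCrux` below; `Design.coreDesign_iff_exactCertificate` landed p120302); the card's bounded-radius,
  lattice-equivariant transfers only make it harder.  Its parts per the card: (a) a Flyspeck-sized certified
  computation over a compact jet family, (b) the tail sections `(★_R)` for ALL `R` ("no finite computation proves
  an infinite conjunction" — the card), (c) linear algebra; and `P₀ = hcp*` must be THE periodic minimiser of `e_LJ`.
* `stub_designForcesKeplerBound` (DIAGNOSTIC, provable now, S; held by the lead): the hypotheses of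
  `stub_composition` already imply route item 11961 `KeplerBound` (↔ shared item 0627 ↔ conjunct (i)
  `HasPeriodicGroundStateEnergy V_LJ 3`, open): the periodic infimum of `e_·(g_f)` is never above `e* + f 0/2`
  (`NoGap.periodicInf_core_le`), so the core bound forces `e_LJ(P₀) = e*`, i.e. `P₀` attains the periodic minimum
  (`keplerBound_of_periodicMinimum`).  It is not used by `ExactCertificate_of`; it certifies where the line stands.

* `stub_designIffCrux` (DIAGNOSTIC, provable now, S; held by the lead): the statement of `stub_design` is
  EQUIVALENT to the crux (`Design.transferDesign_iff_coreDesign` + `Design.coreDesign_iff_exactCertificate`).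

`ExactCertificate_of` below concludes the crux BY NAME from `stub_design`, `stub_localToGlobal`, `stub_composition`
(no `sorry` outside the stubs); `keplerBound_of_stubs` records that the same three hypotheses give `KeplerBound`.

STATUS (skeleton v3 = FINAL for lead a1, 2026-08-16).  Registered stubs: 5.  CLOSED (landed, imported here, no `sorry`):
`stub_localToGlobal` (p120305, `Theorems/ThreeConeCertificateExactCertificateLocalToGlobal.lean`), `stub_composition`
(p120300, `…DesignComposition.lean`), `stub_designForcesKeplerBound` (p120302, `…DesignKepler.lean`, with
`Design.coreDesign_iff_exactCertificate`), `stub_designIffCrux` (p120526, `…DesignIff.lean`; re-proved inline below so the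
work file does not wait for the farm build of that module).  OPEN (the only `sorry`):
`stub_design` — the content, PROVED equivalent to the crux (`stub_designIffCrux`) and implying `KeplerBound`
(`keplerBound_of_stubs`; item 11961 ↔ 0627, open problem).  VERDICT: line dead (L5 third clause) — dead note
`Lines/Ideator5Sketch.dead.md`.
-/

noncomputable section

namespace Summit.AtomisticToContinuum.Crystallization.Cruxes.ExactCertificate.RobustSoftFlyspeck

open Literature.MathematicalPhysics.StatisticalMechanics
open Summit.AtomisticToContinuum.Crystallization.Theses.ThreeConeCertificate
open scoped BigOperators

/-- **stub_localToGlobal — local-to-global with zero-sum transfers, periodic form (provable now, S).**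
If the site functional "half the `g`-site-sum plus transfer" is `≥ −c` at every motif site of every periodic
configuration and the transfers sum to zero over each motif, then `−c ≤ e_Q(g)` for every periodic `Q`
(`e_Q(g) = (2·#motif)⁻¹ Σ_{x ∈ motif} Σ'_{y ∈ Q∖x} g(|x−y|)`; no summability is needed: both sides carry the
same `tsum`).  Signature = `Ideator5Sketch.energyPerParticle_ge_of_localInequality`. -/
theorem stub_localToGlobal : ∀ (g : ℝ → ℝ) (c : ℝ)
    (T : PeriodicConfiguration 3 → EuclideanSpace ℝ (Fin 3) → ℝ),
    (∀ Q : PeriodicConfiguration 3, ∑ x ∈ Q.motif, T Q x = 0) →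
    (∀ (Q : PeriodicConfiguration 3) (x : EuclideanSpace ℝ (Fin 3)), x ∈ Q.motif →
      -c ≤ (2 : ℝ)⁻¹ *
        (∑' y : {y : EuclideanSpace ℝ (Fin 3) // y ∈ Q.points ∧ y ≠ x}, g (dist x y.1)) + T Q x) →
    ∀ Q : PeriodicConfiguration 3, -c ≤ Q.energyPerParticle g :=
  -- LANDED (wave 1, p120305): `Theorems/ThreeConeCertificateExactCertificateLocalToGlobal.lean`.
  Summit.AtomisticToContinuum.Crystallization.Theorems.ThreeConeCertificateExactCertificate.Design.stub_localToGlobal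

/-- **stub_composition — design + periodic core bound ⇒ the crux (provable now, S).**  A template `P₀`,
a range `ρ`, a radial positive-type `f` dominated by `V_LJ` on `[ρ,∞) ∩ (0,∞)`, and the periodic lower bound
`e_LJ(P₀) + f 0/2 ≤ e_Q((V_LJ − f)·1_{(0,ρ)})` for every periodic `Q` give `ExactCertificate` with the
normal-form split `g := (V_LJ − f)1_{(0,ρ)}`, `U := (V_LJ − f)1_{[ρ,∞)}`, `c := −(e_LJ(P₀) + f 0/2)`, (S5) from
`NoGap.stable_of_periodic_bound`.  Signature = `Ideator5Sketch.exactCertificate_of_design_and_periodicCoreBound`. -/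
theorem stub_composition : ∀ (P₀ : PeriodicConfiguration 3) (ρ : ℝ) (f : ℝ → ℝ),
    (∀ (n : ℕ) (y : Fin n → EuclideanSpace ℝ (Fin 3)) (w : Fin n → ℝ),
      0 ≤ ∑ i, ∑ j, w i * w j * f (dist (y i) (y j))) →
    (∀ r : ℝ, ρ ≤ r → 0 < r → f r ≤ lennardJones r) →
    (∀ Q : PeriodicConfiguration 3,
      P₀.energyPerParticle lennardJones + f 0 / 2 ≤
        Q.energyPerParticle (fun r => if r < ρ then lennardJones r - f r else 0)) →
    ExactCertificate :=
  -- LANDED (wave 1, p120300): `Theorems/ThreeConeCertificateExactCertificateDesignComposition.lean`.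
  Summit.AtomisticToContinuum.Crystallization.Theorems.ThreeConeCertificateExactCertificate.Design.stub_composition

/-- **stub_design — THE CONTENT (robust soft Flyspeck, collapsed form; open, hardest; held by the lead).**
A template `P₀`, a range `ρ`, a constant `c`, a radial positive-type `f` with `f ≤ V_LJ` on `[ρ,∞) ∩ (0,∞)`,
and zero-sum transfers `T` certifying the ONE-CENTRE INEQUALITY
`½·Σ'_{y ∈ Q∖x} g_f(|x−y|) + T(Q,x) ≥ −c` at every motif site of every periodic `Q`, for the designed core
`g_f = (V_LJ − f)·1_{(0,ρ)}`, with the value identity `c + f 0/2 = −e_LJ(P₀)`.  (With unrestricted `T` the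
inequality clause is equivalent to `∀ Q, −c ≤ e_Q(g_f)`; the whole stub is then equivalent to the crux and
implies `KeplerBound` — see `keplerBound_of_stubs`.) -/
theorem stub_design : ∃ (P₀ : PeriodicConfiguration 3) (ρ c : ℝ) (f : ℝ → ℝ)
    (T : PeriodicConfiguration 3 → EuclideanSpace ℝ (Fin 3) → ℝ),
    (∀ (n : ℕ) (y : Fin n → EuclideanSpace ℝ (Fin 3)) (w : Fin n → ℝ),
      0 ≤ ∑ i, ∑ j, w i * w j * f (dist (y i) (y j))) ∧
    (∀ r : ℝ, ρ ≤ r → 0 < r → f r ≤ lennardJones r) ∧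
    (∀ Q : PeriodicConfiguration 3, ∑ x ∈ Q.motif, T Q x = 0) ∧
    (∀ (Q : PeriodicConfiguration 3) (x : EuclideanSpace ℝ (Fin 3)), x ∈ Q.motif →
      -c ≤ (2 : ℝ)⁻¹ *
        (∑' y : {y : EuclideanSpace ℝ (Fin 3) // y ∈ Q.points ∧ y ≠ x},
          (fun r => if r < ρ then lennardJones r - f r else 0) (dist x y.1)) + T Q x) ∧
    c + f 0 / 2 = -(P₀.energyPerParticle lennardJones) := by
  sorry

/-- **stub_designForcesKeplerBound — DIAGNOSTIC (provable now, S; held by the lead).**  The hypotheses of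
`stub_composition` imply route item 11961 `KeplerBound` (↔ 0627 ↔ conjunct (i), open): by
`NoGap.periodicInf_core_le` the periodic infimum of `e_·(g_f)` is `≤ e* + f 0/2`, so the core bound forces
`e_LJ(P₀) ≤ e*`, hence `e_LJ(P₀) = e*` (`eStar_le`), and a periodic minimiser gives `KeplerBound`
(`keplerBound_of_periodicMinimum`). -/
theorem stub_designForcesKeplerBound : ∀ (P₀ : PeriodicConfiguration 3) (ρ : ℝ) (f : ℝ → ℝ),
    (∀ (n : ℕ) (y : Fin n → EuclideanSpace ℝ (Fin 3)) (w : Fin n → ℝ),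
      0 ≤ ∑ i, ∑ j, w i * w j * f (dist (y i) (y j))) →
    (∀ r : ℝ, ρ ≤ r → 0 < r → f r ≤ lennardJones r) →
    (∀ Q : PeriodicConfiguration 3,
      P₀.energyPerParticle lennardJones + f 0 / 2 ≤
        Q.energyPerParticle (fun r => if r < ρ then lennardJones r - f r else 0)) →
    KeplerBound :=
  -- LANDED (lead, p120302): `Theorems/ThreeConeCertificateExactCertificateDesignKepler.lean`.
  Summit.AtomisticToContinuum.Crystallization.Theorems.ThreeConeCertificateExactCertificate.Design.stub_designForcesKeplerBound

/-- The canonical zero-sum transfer `T(Q,x) := e_Q(W) − ½·Σ'_{y ∈ Q∖x} W(|x−y|)` has zero motif sum (the definition of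
`e_Q(W)` read backwards).  Inline copy of `Design.sum_canonicalTransfer_eq_zero` (landed p120526), kept here so that this
work file elaborates against modules already built on the farm. -/
theorem sum_canonicalTransfer_eq_zero (W : ℝ → ℝ) (Q : PeriodicConfiguration 3) :
    ∑ x ∈ Q.motif, (Q.energyPerParticle W -
      (2 : ℝ)⁻¹ * ∑' y : {y : EuclideanSpace ℝ (Fin 3) // y ∈ Q.points ∧ y ≠ x}, W (dist x y.1)) = 0 := by
  have hF : (0 : ℝ) < Q.motif.card := by exact_mod_cast Finset.card_pos.2 Q.motif_nonempty
  rw [Finset.sum_sub_distrib, Finset.sum_const, nsmul_eq_mul, ← Finset.mul_sum]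
  unfold PeriodicConfiguration.energyPerParticle
  field_simp
  ring

/-- **stub_designIffCrux — DIAGNOSTIC (LANDED p120526 as `Design.stub_designIffCrux`,
`Theorems/ThreeConeCertificateExactCertificateDesignIff.lean`; re-proved inline here from the built modules).**  The
statement of `stub_design` is EQUIVALENT to the crux: with unrestricted zero-sum transfers the one-centre clause is
equivalent to the periodic core bound (`stub_localToGlobal` one way, the canonical transfer the other), and the core
design is the crux in normal form (`Design.coreDesign_iff_exactCertificate`, p120302). -/
theorem stub_designIffCrux :
    (∃ (P₀ : PeriodicConfiguration 3) (ρ c : ℝ) (f : ℝ → ℝ)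
        (T : PeriodicConfiguration 3 → EuclideanSpace ℝ (Fin 3) → ℝ),
      (∀ (n : ℕ) (y : Fin n → EuclideanSpace ℝ (Fin 3)) (w : Fin n → ℝ),
        0 ≤ ∑ i, ∑ j, w i * w j * f (dist (y i) (y j))) ∧
      (∀ r : ℝ, ρ ≤ r → 0 < r → f r ≤ lennardJones r) ∧
      (∀ Q : PeriodicConfiguration 3, ∑ x ∈ Q.motif, T Q x = 0) ∧
      (∀ (Q : PeriodicConfiguration 3) (x : EuclideanSpace ℝ (Fin 3)), x ∈ Q.motif →
        -c ≤ (2 : ℝ)⁻¹ *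
          (∑' y : {y : EuclideanSpace ℝ (Fin 3) // y ∈ Q.points ∧ y ≠ x},
            (fun r => if r < ρ then lennardJones r - f r else 0) (dist x y.1)) + T Q x) ∧
      c + f 0 / 2 = -(P₀.energyPerParticle lennardJones)) ↔
    ExactCertificate := by
  rw [← Summit.AtomisticToContinuum.Crystallization.Theorems.ThreeConeCertificateExactCertificate.Design.coreDesign_iff_exactCertificate]
  constructor
  · rintro ⟨P₀, ρ, c, f, T, hpd, htail, hzero, hloc, hval⟩
    refine ⟨P₀, ρ, f, hpd, htail, fun Q => ?_⟩
    have h := stub_localToGlobal (fun r => if r < ρ then lennardJones r - f r else 0) c T hzero hloc Q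
    linarith
  · rintro ⟨P₀, ρ, f, hpd, htail, hcore⟩
    refine ⟨P₀, ρ, -(P₀.energyPerParticle lennardJones + f 0 / 2), f,
      fun Q x => Q.energyPerParticle (fun r => if r < ρ then lennardJones r - f r else 0) -
        (2 : ℝ)⁻¹ * ∑' y : {y : EuclideanSpace ℝ (Fin 3) // y ∈ Q.points ∧ y ≠ x},
          (fun r => if r < ρ then lennardJones r - f r else 0) (dist x y.1),
      hpd, htail, fun Q => sum_canonicalTransfer_eq_zero _ Q, fun Q x _ => ?_, by ring⟩
    have h := hcore Q
    linarith

/-- The periodic core bound of `stub_composition` from the design data: kill the transfers with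
`stub_localToGlobal` and rewrite the constant with the value identity. -/
theorem coreBound_of_design {P₀ : PeriodicConfiguration 3} {ρ c : ℝ} {f : ℝ → ℝ}
    {T : PeriodicConfiguration 3 → EuclideanSpace ℝ (Fin 3) → ℝ}
    (hzero : ∀ Q : PeriodicConfiguration 3, ∑ x ∈ Q.motif, T Q x = 0)
    (hloc : ∀ (Q : PeriodicConfiguration 3) (x : EuclideanSpace ℝ (Fin 3)), x ∈ Q.motif →
      -c ≤ (2 : ℝ)⁻¹ *
        (∑' y : {y : EuclideanSpace ℝ (Fin 3) // y ∈ Q.points ∧ y ≠ x},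
          (fun r => if r < ρ then lennardJones r - f r else 0) (dist x y.1)) + T Q x)
    (hval : c + f 0 / 2 = -(P₀.energyPerParticle lennardJones)) :
    ∀ Q : PeriodicConfiguration 3,
      P₀.energyPerParticle lennardJones + f 0 / 2 ≤
        Q.energyPerParticle (fun r => if r < ρ then lennardJones r - f r else 0) := by
  intro Q
  have h := stub_localToGlobal (fun r => if r < ρ then lennardJones r - f r else 0) c T hzero hloc Q
  linarith

/-- **Where the line stands (sorry-free modulo the stubs): its three composing hypotheses give
`KeplerBound`** (route item 11961 ↔ 0627, open) — through the diagnostic stub. -/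
theorem keplerBound_of_stubs : KeplerBound := by
  obtain ⟨P₀, ρ, c, f, T, hpd, htail, hzero, hloc, hval⟩ := stub_design
  exact stub_designForcesKeplerBound P₀ ρ f hpd htail (coreBound_of_design hzero hloc hval)

/-- **COMPOSITION: the stubs give the crux by name.**  `stub_design` supplies `(P₀, ρ, c, f, T)`;
`stub_localToGlobal` turns the one-centre inequality with zero-sum transfers into the periodic core bound;
`stub_composition` builds the normal-form split and discharges (S5) by periodisation. -/
theorem ExactCertificate_of : ExactCertificate := by
  obtain ⟨P₀, ρ, c, f, T, hpd, htail, hzero, hloc, hval⟩ := stub_design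
  exact stub_composition P₀ ρ f hpd htail (coreBound_of_design hzero hloc hval)

end Summit.AtomisticToContinuum.Crystallization.Cruxes.ExactCertificate.RobustSoftFlyspeck

end
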